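import Literature.Computability.FineGrained.LightSatProg
import HarnessLib

/-!
# Exhaustive search of light assignments, III: the machine; `lightKSAT_exhaustiveSearch`

Family `fine-grained` (trunk T-CPLX-FINE). This file finishes the discharge of the named fact
`Literature.Computability.FineGrained.lightKSAT_exhaustiveSearch` (`KSatExponentGap.lean`; Impagliazzo–Paturi 2001,
p. 370 and proof of Theorem 3, step 1: the assignments with at most `δ n` ones, `δ = 1/N`,
`N ≥ 2`, can be searched exhaustively in time `2^{h(δ) n} · poly(L)`):

* `runs_prelude` — the prelude of the program (`LightSatProg.prelude`) turns the coded input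
  `code(numVars) code(F)` into the initial worklist `unit^q code(F) endf` with the budget
  `q = ⌊min(n, N (m + 1)) / N⌋ = min(⌊n/N⌋, m + 1)` (`m` = number of literal occurrences;
  `budget_eq`);
* `runs_body_*` — one iteration of the worklist loop realises one step of the budgeted search
  `searchB` on the coded worklist (`wl`), within `O(M³)` steps for a worklist of `M` bits;
* `mainLoop_spec` — by induction on the fuel of `searchB`: the loop halts with `[true]` in
  `out` iff some pending `(b, F)` has `LightSat F b`, within `(#nodes) · O(M³)` steps;
* `lightSat_budget_iff` — the capped budget does not change the answer
  (`LightSat F (min(⌊n/N⌋, m + 1)) ↔ LightSat F ⌊n/N⌋`, as at most `#vars ≤ m` ones can be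
  placed on the variables), and `lightSat_formulaOf_iff` turns it into
  `φ.LightSatisfiable (numVars / N)`;
* the running time: `#nodes ≤ (d + 1) · Σ_{j ≤ q} (d choose j) ≤ (d + 1) · Σ_{j ≤ ⌊n/N⌋} (n choose j)`
  (`nodesB_le`, `d ≤ n`), and van Lint's entropy estimate `≤ 2^{h(1/N) n}`
  (`sumChoose_le_two_rpow`) give the `IsExpPolyBound (binEntropy N⁻¹ / log 2)` bound
  `T n L = 10¹⁰ · N · (L + 1)⁷ · Σ_{j ≤ ⌊n/N⌋} (n choose j)`;
* `lightKSAT_exhaustiveSearch_holds : lightKSAT_exhaustiveSearch`.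

## References

* R. Impagliazzo, R. Paturi, *On the complexity of k-SAT*, JCSS 62 (2001), p. 370 and proof
  of Theorem 3, step 1 (p. 374).
* J. H. van Lint, *Introduction to Coding Theory*, 2nd ed., Springer 1992, Theorem 1.4.5 (i).
* M. Davis, G. Logemann, D. Loveland, *A machine program for theorem-proving*, Comm. ACM 5
  (1962), 394–397 (the splitting rule).
-/

namespace Literature.Computability.FineGrained.LightSearch

open Complexity Complexity.Com _root_.Computability Turing

/-! ### The coded worklist -/

/-- The token string of a worklist: each entry is its budget in units, its formula, `endf`. [folklore] -/
def wl (W : List (ℕ × CNF (List Bool))) : List Tok :=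
  W.flatMap fun p => List.replicate p.1 Tok.unit ++ (formulaToks p.2 ++ [Tok.endf])

/-- `wl` of the empty worklist. [folklore] -/
@[simp] theorem wl_nil : wl [] = [] := rfl

/-- `wl` of a cons. [folklore] -/
@[simp] theorem wl_cons (b : ℕ) (F : CNF (List Bool)) (W : List (ℕ × CNF (List Bool))) :
    wl ((b, F) :: W) = List.replicate b Tok.unit ++ (formulaToks F ++ Tok.endf :: wl W) := by
  simp [wl]

/-- No `endf` and no `unit` inside the code of a formula. [folklore] -/
theorem endf_unit_not_mem_formulaToks (F : CNF (List Bool)) :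
    Tok.endf ∉ formulaToks F ∧ Tok.unit ∉ formulaToks F := by
  induction F with
  | nil => simp
  | cons c F ih =>
    rw [formulaToks_cons, List.mem_append, List.mem_append, not_or, not_or]
    refine ⟨⟨?_, ih.1⟩, ⟨?_, ih.2⟩⟩ <;>
    · simp only [clauseToks, List.mem_append, List.mem_singleton, List.mem_flatMap, not_or]
      refine ⟨?_, by decide⟩
      rintro ⟨l, -, hl⟩
      simp [litToks] at hl

/-- The pivot bits are index bits of the formula. [folklore] -/
theorem length_scanX_le (F : CNF (List Bool)) : (scanX F).length ≤ (formulaToks F).length := by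
  induction F with
  | nil => simp [scanX]
  | cons c F ih =>
    rcases c with _ | ⟨⟨w, b⟩, c⟩
    · simp only [scanX, formulaToks_cons, List.length_append]; omega
    · simp [scanX, clauseToks, litToks]; omega

/-- Length of the coded worklist. [folklore] -/
theorem length_bits_wl (W : List (ℕ × CNF (List Bool))) :
    (bits (wl W)).length = (W.map fun p => 5 * p.1 + (bits (formulaToks p.2)).length + 5).sum := by
  induction W with
  | nil => simp
  | cons p W ih =>
    obtain ⟨b, F⟩ := p
    simp only [wl_cons, bits_append, bits_cons, List.length_append, List.length_cons, ih,
      List.map_cons, List.sum_cons, bits_replicate, List.length_flatten, List.map_replicate,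
      List.sum_replicate, Tok.code, List.length_nil, smul_eq_mul]
    ring

/-- Under uniform bounds on budgets and formulas, the coded worklist has length at most
`|W| · (5 B₀ + m₀ + 5)`. [folklore] -/
theorem length_bits_wl_le (W : List (ℕ × CNF (List Bool))) (m₀ B₀ : ℕ)
    (h : ∀ p ∈ W, (bits (formulaToks p.2)).length ≤ m₀ ∧ p.1 ≤ B₀) :
    (bits (wl W)).length ≤ W.length * (5 * B₀ + m₀ + 5) := by
  rw [length_bits_wl]
  induction W with
  | nil => simp
  | cons p W ih =>
    have h1 := h p (by simp)
    have h2 := ih fun q hq => h q (by simp [hq])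
    simp only [List.map_cons, List.sum_cons, List.length_cons]
    rw [Nat.add_mul, Nat.one_mul]
    have hK : 5 * p.1 + (bits (formulaToks p.2)).length + 5 ≤ 5 * B₀ + m₀ + 5 := by
      have := h1.1; have := h1.2; omega
    have := Nat.add_le_add hK h2
    omega

/-! ### One iteration of the worklist loop -/

/-- The register file between iterations: the coded worklist in `w`, everything else empty. [folklore] -/
def stW (l : List Bool) : RF := { RF.zero with w := l }

/-- `stW` as an update of the empty file. [folklore] -/
theorem mk_stW (l : List Bool) : mk (stW l) = Regs.init R.w l := by
  rw [init_w]; rfl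

/-- `specFold` on a nonempty token string does not read the loop register. [folklore] -/
theorem specFold_cons_setW (t : Tok) (ts : List Tok) (ρ : RF) (l : List Bool) :
    specFold exS setW (t :: ts) (setW ρ l) = specFold exS setW (t :: ts) ρ := by
  simp [specFold, setW]

section Body

variable (b : ℕ) (F : CNF (List Bool)) (W : List (ℕ × CNF (List Bool)))

/-- The first token and the remaining tokens of a nonempty worklist. [folklore] -/
theorem wl_cons_eq_cons :
    ∃ t ts, wl ((b, F) :: W) = t :: ts := by
  rcases h : wl ((b, F) :: W) with _ | ⟨t, ts⟩
  · have := congrArg List.length h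
    simp at this
  · exact ⟨t, ts, rfl⟩

/-- **Closed form of the extraction of the top entry**: budget to `bu`, formula to `fr`
(reversed code), rest to `w2`. [folklore] -/
theorem specFold_exS_entry {t : Tok} {ts : List Tok} (hts : wl ((b, F) :: W) = t :: ts) :
    specFold exS setW (t :: ts) (stW (bits (t :: ts))) =
      { RF.zero with
        fr := (bits (formulaToks F)).reverse, w2 := (bits (wl W)).reverse, md := [true],
        bu := List.replicate b true } := by
  obtain ⟨t', ts', e'⟩ : ∃ t' ts', formulaToks F ++ Tok.endf :: wl W = t' :: ts' := by
    rcases h : formulaToks F with _ | ⟨t', ts'⟩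
    · exact ⟨Tok.endf, wl W, by simp⟩
    · exact ⟨t', ts' ++ Tok.endf :: wl W, by simp⟩
  -- closed form of the extraction of `A ++ endf :: B` from any file in mode `[]`
  have key : ∀ ρ : RF, ρ.md = [] → specFold exS setW (t' :: ts') ρ =
      { ρ with
        w := [], fr := (bits (formulaToks F)).reverse ++ ρ.fr,
        w2 := (bits (wl W)).reverse ++ ρ.w2, md := [true] } := by
    intro ρ h
    rw [← specFold_cons_setW t' ts' ρ (bits (t' :: ts')), ← e']
    rw [specFold_exS (formulaToks F) (wl W) (endf_unit_not_mem_formulaToks F).1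
      (endf_unit_not_mem_formulaToks F).2 (setW ρ (bits (formulaToks F ++ Tok.endf :: wl W)))
      (by simp [setW, h]) (by simp [setW])]
    simp [setW]
  rw [← hts, wl_cons, e', specFold_exS_units _ _ _ _ (by simp [stW]), key _ (by simp [stW])]
  simp [stW]

/-- **Phases A–B of the body** (extraction, mode reset, formula in reading order), in
continuation form. [folklore] -/
theorem runs_bodyAB {t : Tok} {ts : List Tok} (hts : wl ((b, F) :: W) = t :: ts)
    {K : Com R} {R' : Regs R} {B : ℕ} :
    (Runs K (mk
        { RF.zero with
          f := bits (formulaToks F), w2 := (bits (wl W)).reverse, bu := List.replicate b true }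
        ) R' B →
      Runs (tokCase .w extractH t.hd ;; tokLoop .w extractH ;; clear .md ;; pour .fr .f ;; K)
        (mk (stW (t.tl ++ bits ts))) R' (21 * (bits (wl ((b, F) :: W))).length + 24 + B)) ∧
    (Halts K (mk
        { RF.zero with
          f := bits (formulaToks F), w2 := (bits (wl W)).reverse, bu := List.replicate b true }
        ) R' B →
      Halts (tokCase .w extractH t.hd ;; tokLoop .w extractH ;; clear .md ;; pour .fr .f ;; K)
        (mk (stW (t.tl ++ bits ts))) R' (21 * (bits (wl ((b, F) :: W))).length + 24 + B)) := by
  -- A: the first token, then the loop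
  set ρB : RF := stW (bits ts) with hρB
  have h1 : Runs (extractH.run t) (Function.update (mk (stW (t.tl ++ bits ts))) .w (bits ts))
      (mk (exS t ρB)) 8 := by
    rw [extractH_run, show Function.update (mk (stW (t.tl ++ bits ts))) R.w (bits ts) = mk ρB by
      simp [stW, hρB]]
    exact runs_extractTok t ρB (Or.inl rfl)
  have hA := runs_tokCase (k := .w) (H := extractH) (t := t) (rest := bits ts)
    (Rg := mk (stW (t.tl ++ bits ts))) (by simp [stW]) h1
  have hL := runs_extractLoop ts (exS t ρB) (exP_exS t ρB (Or.inl rfl)) (by rw [exS_w]; simp [hρB, stW])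
  have hcost := costFold_exS_le ts (exS t ρB)
  have hspec : specFold exS setW ts (exS t ρB) =
      { RF.zero with
        fr := (bits (formulaToks F)).reverse, w2 := (bits (wl W)).reverse, md := [true],
        bu := List.replicate b true } := by
    have e := specFold_exS_entry b F W hts
    rw [specFold] at e
    have : setW (stW (bits (t :: ts))) (bits ts) = ρB := by simp [setW, stW, hρB]
    rwa [this] at e
  rw [hspec] at hL
  -- B: clear md, pour fr f
  set ρ₂ : RF :=
    { RF.zero with
      fr := (bits (formulaToks F)).reverse, w2 := (bits (wl W)).reverse, md := [true],
      bu := List.replicate b true } with hρ₂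
  have hC : Runs (clear R.md) (mk ρ₂) (mk { ρ₂ with md := [] }) 3 :=
    (runs_clear R.md (mk ρ₂)).of_eq (by simp [hρ₂]) (by simp [hρ₂])
  have hP : Runs (pour R.fr R.f) (mk { ρ₂ with md := [] })
      (mk
          { RF.zero with
            f := bits (formulaToks F), w2 := (bits (wl W)).reverse, bu := List.replicate b true })
      (3 * (bits (formulaToks F)).length + 1) :=
    (runs_pour (a := R.fr) (b := R.f) (by decide) (mk { ρ₂ with md := [] })).of_eq
      (by simp [hρ₂]) (by simp [hρ₂])
  have hl1 : t.tl.length ≤ 4 := by cases t <;> simp [Tok.tl]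
  have hl2 : ts.length ≤ (bits ts).length := length_le_length_bits ts
  have hl3 : (bits (wl ((b, F) :: W))).length = t.code.length + (bits ts).length := by
    rw [hts]; simp
  have hl5 : (bits (formulaToks F)).length ≤ (bits (wl ((b, F) :: W))).length := by
    simp only [wl_cons, bits_append, bits_cons, List.length_append]; omega
  constructor
  · intro hK
    exact (hA.seq (hL.seq (hC.seq (hP.seq hK)))).mono (by omega)
  · intro hK
    exact (hA.seq_halts (hL.seq_halts (hC.seq_halts (hP.seq_halts hK)))).mono (by omega)

/-- The budget is at most a fifth of the coded worklist. [folklore] -/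
theorem budget_le_length : 5 * b ≤ (bits (wl ((b, F) :: W))).length := by
  simp only [wl_cons, bits_append, List.length_append, bits_replicate, List.length_flatten,
    List.map_replicate, List.sum_replicate, Tok.code, smul_eq_mul, List.length_cons,
    List.length_nil]
  omega

/-- **The body on an empty formula**: the search has found a lightly satisfiable (empty)
formula; the body stops the program with `[true]` in `out` and everything else empty. [folklore] -/
theorem halts_body_nil {t : Tok} {ts : List Tok} (hts : wl ((b, ([] : CNF (List Bool))) :: W) = t :: ts) :
    Halts (body t.hd) (mk (stW (t.tl ++ bits ts))) (mk { RF.zero with out := [true] })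
      (24 * (bits (wl ((b, ([] : CNF (List Bool))) :: W))).length + 31) := by
  set ρ₁ : RF :=
      { RF.zero with
        f := bits (formulaToks []), w2 := (bits (wl W)).reverse, bu := List.replicate b true }
      with hρ₁
  have hF : Halts found (mk ρ₁) (mk { RF.zero with out := [true] })
      (2 * (bits (wl W)).length + 1 + (2 * b + 1) + 2) := by
    have h1 : Runs (clear R.w2) (mk ρ₁) (mk { RF.zero with bu := List.replicate b true })
        (2 * (bits (wl W)).length + 1) :=
      (runs_clear R.w2 (mk ρ₁)).of_eq (by simp [hρ₁]) (by simp [hρ₁])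
    have h2 : Runs (clear R.bu) (mk { RF.zero with bu := List.replicate b true }) (mk RF.zero) (2 * b + 1) :=
      (runs_clear R.bu _).of_eq (by simp [RF.zero]) (by simp)
    have h3 := Runs.push R.out true (mk RF.zero)
    have h4 := Halts.halt (Function.update (mk RF.zero) R.out (true :: mk RF.zero R.out))
    exact ((h1.seq_halts (h2.seq_halts (h3.seq_halts h4))).congr (by simp)).mono (by omega)
  have hpop : Halts (.pop .f (.push .f true) (.push .f false) found ;;
      (scan ;; pour .f2r .f2 ;; pour .xr .x ;;
        .pop .he (clear .f2 ;; clear .x ;; clear .bu ;; pour .w2 .w)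
          (clear .f2 ;; clear .x ;; clear .bu ;; pour .w2 .w) splitStep)) (mk ρ₁)
      (mk { RF.zero with out := [true] }) (2 * (bits (wl W)).length + 1 + (2 * b + 1) + 2 + 2) :=
    Halts.seq _ (Halts.pop_nil _ _ (by simp [hρ₁]) hF)
  have H := (runs_bodyAB b [] W hts).2 hpop
  refine H.mono ?_
  have h1 : (bits (wl W)).length ≤ (bits (wl ((b, ([] : CNF (List Bool))) :: W))).length := by
    simp only [wl_cons, bits_append, bits_cons, List.length_append]; omega
  have h2 := budget_le_length b ([] : CNF (List Bool)) W
  omega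

/-- The code of a nonempty formula is a nonempty bit string. [folklore] -/
theorem bits_formulaToks_ne_nil (hF : F ≠ []) : bits (formulaToks F) ≠ [] := by
  obtain ⟨c, F', rfl⟩ := List.exists_cons_of_ne_nil hF
  rw [formulaToks_cons, clauseToks, bits_append, bits_append]
  simp [Tok.code]

/-- **Phases C–E of the body** (nonemptiness test, scan, copies in reading order), in
continuation form. [folklore] -/
theorem runs_bodyCDE (hF : F ≠ []) {K : Com R} {R' : Regs R} {B : ℕ}
    (hK : Runs K
      (mk
        { RF.zero with
          w2 := (bits (wl W)).reverse, f2 := bits (formulaToks F),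
          x := scanX F, he := if [] ∈ F then [true] else [], bu := List.replicate b true }) R' B) :
    Runs (.pop .f (.push .f true) (.push .f false) found ;; scan ;; pour .f2r .f2 ;; pour .xr .x ;; K)
      (mk
          { RF.zero with
            f := bits (formulaToks F), w2 := (bits (wl W)).reverse, bu := List.replicate b true }
          ) R'
      (27 * (bits (wl ((b, F) :: W))).length + 13 + B) := by
  set ρ₁ : RF :=
      { RF.zero with
        f := bits (formulaToks F), w2 := (bits (wl W)).reverse, bu := List.replicate b true }
      with hρ₁
  -- C: the test pops a bit and pushes it back
  have hC : Runs (.pop .f (.push .f true) (.push .f false) found) (mk ρ₁) (mk ρ₁) 3 := by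
    obtain ⟨c, rest, hb⟩ := List.exists_cons_of_ne_nil (bits_formulaToks_ne_nil F hF)
    cases c
    · refine (Runs.pop_false' _ _ (by simp [hρ₁, hb]) (update_mk_f ρ₁ rest)
        (Runs.push R.f false _)).of_eq ?_ (by omega)
      simp [hρ₁, hb]
    · refine (Runs.pop_true' _ _ (by simp [hρ₁, hb]) (update_mk_f ρ₁ rest)
        (Runs.push R.f true _)).of_eq ?_ (by omega)
      simp [hρ₁, hb]
  -- D: scan
  have hD := runs_scan F ρ₁ (by simp [hρ₁]) (by simp [hρ₁]) (Or.inl (by simp [hρ₁])) (by simp [hρ₁])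
  set ρ₄ : RF :=
    { RF.zero with
      w2 := (bits (wl W)).reverse,
      f2r := (bits (formulaToks F)).reverse, xr := (scanX F).reverse,
      he := if [] ∈ F then [true] else [], bu := List.replicate b true } with hρ₄
  have hD' : Runs scan (mk ρ₁) (mk ρ₄) (21 * (formulaToks F).length + 8) :=
    hD.of_eq (by simp [hρ₁, hρ₄]) le_rfl
  -- E: pour f2r f2, pour xr x
  have hE1 : Runs (pour R.f2r R.f2) (mk ρ₄) (mk { ρ₄ with f2r := [], f2 := bits (formulaToks F) })
      (3 * (bits (formulaToks F)).length + 1) :=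
    (runs_pour (a := R.f2r) (b := R.f2) (by decide) (mk ρ₄)).of_eq (by simp [hρ₄]) (by simp [hρ₄])
  have hE2 : Runs (pour R.xr R.x) (mk { ρ₄ with f2r := [], f2 := bits (formulaToks F) })
      (mk
        { RF.zero with
          w2 := (bits (wl W)).reverse, f2 := bits (formulaToks F),
          x := scanX F, he := if [] ∈ F then [true] else [], bu := List.replicate b true })
      (3 * (scanX F).length + 1) :=
    (runs_pour (a := R.xr) (b := R.x) (by decide) _).of_eq (by simp [hρ₄]) (by simp [hρ₄])
  refine (hC.seq (hD'.seq (hE1.seq (hE2.seq hK)))).mono ?_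
  have hl1 : (formulaToks F).length ≤ (bits (formulaToks F)).length := length_le_length_bits _
  have hl2 : (bits (formulaToks F)).length ≤ (bits (wl ((b, F) :: W))).length := by
    simp only [wl_cons, bits_append, bits_cons, List.length_append]; omega
  have hl3 := length_scanX_le F
  omega

/-- **The body on a formula with an empty clause**: the entry is dropped, the rest of the
worklist restored. [folklore] -/
theorem runs_body_drop (hF : F ≠ []) (he : [] ∈ F) {t : Tok} {ts : List Tok}
    (hts : wl ((b, F) :: W) = t :: ts) :
    Runs (body t.hd) (mk (stW (t.tl ++ bits ts))) (mk (stW (bits (wl W))))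
      (56 * (bits (wl ((b, F) :: W))).length + 46) := by
  set ρ₆ : RF :=
    { RF.zero with
      w2 := (bits (wl W)).reverse, f2 := bits (formulaToks F),
      x := scanX F, he := if [] ∈ F then [true] else [], bu := List.replicate b true } with hρ₆
  have h1 : Runs (clear R.f2) (mk { ρ₆ with he := [] }) (mk { ρ₆ with he := [], f2 := [] })
      (2 * (bits (formulaToks F)).length + 1) :=
    (runs_clear R.f2 _).of_eq (by simp [hρ₆]) (by simp [hρ₆])
  have h2 : Runs (clear R.x) (mk { ρ₆ with he := [], f2 := [] }) (mk { ρ₆ with he := [], f2 := [], x := [] })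
      (2 * (scanX F).length + 1) :=
    (runs_clear R.x _).of_eq (by simp [hρ₆]) (by simp [hρ₆])
  have h3 : Runs (clear R.bu) (mk { ρ₆ with he := [], f2 := [], x := [] })
      (mk { ρ₆ with he := [], f2 := [], x := [], bu := [] }) (2 * b + 1) :=
    (runs_clear R.bu _).of_eq (by simp [hρ₆]) (by simp [hρ₆])
  have h4 : Runs (pour R.w2 R.w) (mk { ρ₆ with he := [], f2 := [], x := [], bu := [] }) (mk (stW (bits (wl W))))
      (3 * (bits (wl W)).length + 1) :=
    (runs_pour (a := R.w2) (b := R.w) (by decide) _).of_eq (by simp [hρ₆, stW]) (by simp [hρ₆])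
  have hK : Runs (.pop .he (clear .f2 ;; clear .x ;; clear .bu ;; pour .w2 .w)
      (clear .f2 ;; clear .x ;; clear .bu ;; pour .w2 .w) splitStep) (mk ρ₆) (mk (stW (bits (wl W))))
      (2 * (bits (formulaToks F)).length + 1 + (2 * (scanX F).length + 1 + (2 * b + 1 +
        (3 * (bits (wl W)).length + 1))) + 2) :=
    Runs.pop_true' _ _ (by simp [hρ₆, he]) (update_mk_he ρ₆ []) (h1.seq (h2.seq (h3.seq h4)))
  have H := (runs_bodyAB b F W hts).1 (runs_bodyCDE b F W hF hK)
  refine H.mono ?_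
  have hl1 : (bits (formulaToks F)).length ≤ (bits (wl ((b, F) :: W))).length := by
    simp only [wl_cons, bits_append, bits_cons, List.length_append]; omega
  have hl2 : (bits (wl W)).length ≤ (bits (wl ((b, F) :: W))).length := by
    simp only [wl_cons, bits_append, bits_cons, List.length_append]; omega
  have hl3 := length_scanX_le F
  have hl4 : (formulaToks F).length ≤ (bits (formulaToks F)).length := length_le_length_bits _
  have hl5 := budget_le_length b F W
  omega

/-- The cost of one restriction pass, relaxed to the worklist size `m`. [folklore] -/
def reBound (m : ℕ) : ℕ := m * (10 * (m + (4 + m) * m) + 50) + 10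

/-- **Pushing budget units from `tt`**: the loop prepends one `unit` code per unary unit,
within `7 j + 1` steps. [folklore] -/
theorem runs_pushUnits_tt (j : ℕ) : ∀ (ρ : RF), ρ.tt = List.replicate j true →
    Runs (.loop .tt pushUnit pushUnit) (mk ρ)
      (mk { ρ with tt := [], w := bits (List.replicate j Tok.unit) ++ ρ.w }) (7 * j + 1) := by
  induction j with
  | zero =>
    intro ρ h
    refine (Runs.loop_nil _ _ (by simp [h])).of_eq ?_ (by omega)
    cases ρ; simp only at h; subst h; simp
  | succ j ih =>
    intro ρ h
    have h1 : Runs pushUnit (mk { ρ with tt := List.replicate j true })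
        (mk { ρ with tt := List.replicate j true, w := Tok.unit.code ++ ρ.w }) 5 :=
      (GenProg.runs_pushes R.w Tok.unit.code.reverse _).of_eq (by simp) (by simp [Tok.code])
    have h2 := ih { ρ with tt := List.replicate j true, w := Tok.unit.code ++ ρ.w } rfl
    refine (Runs.loop_true' (show mk ρ R.tt = true :: List.replicate j true by
      simp [h, List.replicate_succ]) (update_mk_tt ρ _) h1 h2).of_eq ?_ (by omega)
    simp [List.replicate_succ', List.append_assoc]

/-- **Pushing budget units from `bu`**: the loop prepends one `unit` code per unary unit,
within `7 j + 1` steps. [folklore] -/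
theorem runs_pushUnits_bu (j : ℕ) : ∀ (ρ : RF), ρ.bu = List.replicate j true →
    Runs (.loop .bu pushUnit pushUnit) (mk ρ)
      (mk { ρ with bu := [], w := bits (List.replicate j Tok.unit) ++ ρ.w }) (7 * j + 1) := by
  induction j with
  | zero =>
    intro ρ h
    refine (Runs.loop_nil _ _ (by simp [h])).of_eq ?_ (by omega)
    cases ρ; simp only at h; subst h; simp
  | succ j ih =>
    intro ρ h
    have h1 : Runs pushUnit (mk { ρ with bu := List.replicate j true })
        (mk { ρ with bu := List.replicate j true, w := Tok.unit.code ++ ρ.w }) 5 :=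
      (GenProg.runs_pushes R.w Tok.unit.code.reverse _).of_eq (by simp) (by simp [Tok.code])
    have h2 := ih { ρ with bu := List.replicate j true, w := Tok.unit.code ++ ρ.w } rfl
    refine (Runs.loop_true' (show mk ρ R.bu = true :: List.replicate j true by
      simp [h, List.replicate_succ]) (update_mk_bu ρ _) h1 h2).of_eq ?_ (by omega)
    simp [List.replicate_succ', List.append_assoc]

/-- The worklist after the `x := true` child: `unit^{b-1} code(F₁) endf rest` if `b ≥ 1`. [folklore] -/
def wTrue (b : ℕ) (F1 : CNF (List Bool)) (rest : List Bool) : List Bool :=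
  match b with
  | 0 => rest
  | b + 1 => bits (List.replicate b Tok.unit) ++ (bits (formulaToks F1) ++ Tok.endf.code ++ rest)

/-- **The splitting step**: from `w2` = stashed rest, `f2 = code F`, `x` = the pivot `x₀`, budget
`b` in `bu`, `splitStep` rebuilds the worklist as
`unit^b code F[x₀:=false] endf [unit^{b-1} code F[x₀:=true] endf] rest`, the bracket only if
`b ≥ 1`. [cite: ImpagliazzoPaturiJCSS2001, p. 370; Davis–Logemann–Loveland 1962] -/
theorem runs_splitStep (x₀ : List Bool) (hx : x₀.length ≤ (bits (wl ((b, F) :: W))).length) :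
    Runs splitStep
      (mk
          { RF.zero with
            w2 := (bits (wl W)).reverse, f2 := bits (formulaToks F), x := x₀,
            bu := List.replicate b true })
      (mk (stW (bits (List.replicate b Tok.unit) ++ (bits (formulaToks (restrict F x₀ false)) ++
        Tok.endf.code ++ wTrue b (restrict F x₀ true) (bits (wl W))))))
      (2 * reBound (bits (wl ((b, F) :: W))).length + 40 * (bits (wl ((b, F) :: W))).length + 60) := by
  set m := (bits (wl ((b, F) :: W))).length with hm
  set A := formulaToks F with hA
  set F0 := restrict F x₀ false with hF0
  set F1 := restrict F x₀ true with hF1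
  have hl1 : (bits A).length ≤ m := by
    simp only [hm, hA, wl_cons, bits_append, bits_cons, List.length_append]; omega
  have hl2 : A.length ≤ m := (length_le_length_bits A).trans hl1
  have hl3 : (bits (wl W)).length ≤ m := by
    simp only [hm, wl_cons, bits_append, bits_cons, List.length_append]; omega
  have hl4 : (bits (formulaToks F1)).length ≤ m :=
    (length_bits_formulaToks_restrict_le F x₀ true).trans hl1
  have hl5 : (bits (formulaToks F0)).length ≤ m :=
    (length_bits_formulaToks_restrict_le F x₀ false).trans hl1
  have hb : 5 * b ≤ m := budget_le_length b F W
  have hR : A.length * (10 * (x₀.length + (4 + x₀.length) * A.length) + 50) + 10 ≤ reBound m := by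
    unfold reBound; gcongr
  -- pour w2 w
  set ρ₆ : RF :=
      { RF.zero with
        w2 := (bits (wl W)).reverse, f2 := bits A, x := x₀, bu := List.replicate b true } with hρ₆
  set ρ₇ : RF := { RF.zero with w := bits (wl W), f2 := bits A, x := x₀, bu := List.replicate b true } with hρ₇
  have h1 : Runs (pour R.w2 R.w) (mk ρ₆) (mk ρ₇) (3 * (bits (wl W)).length + 1) :=
    (runs_pour (a := R.w2) (b := R.w) (by decide) _).of_eq (by simp [hρ₆, hρ₇]) (by simp [hρ₆])
  -- the budget test and the `x := true` child
  set ρ₉ : RF :=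
      { RF.zero with
        w := wTrue b F1 (bits (wl W)), x := x₀, f3r := (bits A).reverse,
        bu := List.replicate b true } with hρ₉
  have h2 : Runs (.pop .bu
      (.push .bu true ;; restrictPass true true .f2 ;; emit .o .endf ;; pour .o .w ;;
        copy .bu .tt .t .u ;; .pop .tt .skip .skip .skip ;; .loop .tt pushUnit pushUnit)
      (.push .bu true ;; restrictPass true true .f2 ;; emit .o .endf ;; pour .o .w ;;
        copy .bu .tt .t .u ;; .pop .tt .skip .skip .skip ;; .loop .tt pushUnit pushUnit)
      (pour .f2 .f3r)) (mk ρ₇) (mk ρ₉) (reBound m + 14 * m + 20) := by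
    rcases b with _ | b'
    · -- no budget: just move the formula
      have hp : Runs (pour R.f2 R.f3r) (mk ρ₇) (mk ρ₉) (3 * (bits A).length + 1) :=
        (runs_pour (a := R.f2) (b := R.f3r) (by decide) _).of_eq (by simp [hρ₇, hρ₉, wTrue]) (by simp [hρ₇])
      exact (Runs.pop_nil _ _ (by simp [hρ₇]) hp).mono (by omega)
    · -- budget `b' + 1`: the true child with budget `b'`
      set ρa : RF := { ρ₇ with bu := List.replicate b' true } with hρa
      have s1 : Runs (.push .bu true) (mk ρa) (mk ρ₇) 1 :=
        (Runs.push R.bu true _).of_eq (by simp [hρa, hρ₇, List.replicate_succ]) le_rfl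
      set ρ₈ : RF :=
          { RF.zero with
            w := bits (wl W), x := x₀, o := (bits (formulaToks F1)).reverse,
            f3r := (bits A).reverse, bu := List.replicate (b' + 1) true } with hρ₈
      have s2 : Runs (restrictPass true true .f2) (mk ρ₇) (mk ρ₈)
          (A.length * (10 * (x₀.length + (4 + x₀.length) * A.length) + 50) + 10) := by
        have := runs_restrictPass true true R.f2 (Or.inl rfl) F ρ₇ (by simp [hρ₇]) (by simp [hρ₇])
          (by simp [hρ₇]) (by simp [hρ₇]) (by simp [hρ₇]) (by simp [hρ₇]) (by simp [hρ₇]) (by simp [hρ₇])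
          (by simp [hρ₇, hA])
        refine this.of_eq ?_ (by simp [hρ₇, hA])
        simp [hρ₇, hρ₈, setSrc, hF1, hA]
      have s3 : Runs (emit R.o .endf) (mk ρ₈) (mk { ρ₈ with o := Tok.endf.code.reverse ++ ρ₈.o }) 5 :=
        (runs_emit R.o .endf (mk ρ₈)).of_eq (by simp [hρ₈]) le_rfl
      set ρ₁₀ : RF :=
          { RF.zero with
            w := bits (formulaToks F1) ++ Tok.endf.code ++ bits (wl W), x := x₀,
            f3r := (bits A).reverse, bu := List.replicate (b' + 1) true } with hρ₁₀
      have s4 : Runs (pour R.o R.w) (mk { ρ₈ with o := Tok.endf.code.reverse ++ ρ₈.o }) (mk ρ₁₀)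
          (3 * ((bits (formulaToks F1)).length + 5) + 1) :=
        (runs_pour (a := R.o) (b := R.w) (by decide) _).of_eq (by simp [hρ₈, hρ₁₀, Tok.code])
          (by simp [hρ₈, Tok.code])
      have s5 : Runs (copy R.bu R.tt R.t R.u) (mk ρ₁₀) (mk { ρ₁₀ with tt := List.replicate (b' + 1) true })
          (10 * (b' + 1) + 3) :=
        (runs_copy (a := R.bu) (b := R.tt) (t := R.t) (u := R.u) (by decide) (by decide) (by decide)
          (by decide) (by decide) (by decide) (mk ρ₁₀) (by simp [hρ₁₀]) (by simp [hρ₁₀])).of_eq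
          (by simp [hρ₁₀]) (by simp [hρ₁₀])
      have s6 : Runs (.pop .tt .skip .skip .skip) (mk { ρ₁₀ with tt := List.replicate (b' + 1) true })
          (mk { ρ₁₀ with tt := List.replicate b' true }) 2 :=
        Runs.pop_true' _ _ (by simp [List.replicate_succ]) (update_mk_tt _ _) (Runs.skip _)
      have s7 := runs_pushUnits_tt b' { ρ₁₀ with tt := List.replicate b' true } (by simp)
      have s7' : Runs (.loop .tt pushUnit pushUnit) (mk { ρ₁₀ with tt := List.replicate b' true })
          (mk ρ₉) (7 * b' + 1) := by
        refine s7.of_eq ?_ le_rfl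
        simp [hρ₁₀, hρ₉, wTrue, List.append_assoc]
      have chain := s1.seq (s2.seq (s3.seq (s4.seq (s5.seq (s6.seq s7')))))
      refine (Runs.pop_true' _ _ (show mk ρ₇ R.bu = true :: List.replicate b' true by
        simp [hρ₇, List.replicate_succ]) (by simp [hρ₇, hρa]) chain).mono ?_
      omega
  -- pour f3r f3
  set ρ₁₁ : RF :=
      { RF.zero with
        w := wTrue b F1 (bits (wl W)), x := x₀, f3 := bits A, bu := List.replicate b true }
      with hρ₁₁
  have h3 : Runs (pour R.f3r R.f3) (mk ρ₉) (mk ρ₁₁) (3 * (bits A).length + 1) :=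
    (runs_pour (a := R.f3r) (b := R.f3) (by decide) _).of_eq (by simp [hρ₉, hρ₁₁]) (by simp [hρ₉])
  -- second restriction pass
  set ρ₁₂ : RF := { ρ₁₁ with f3 := [], o := (bits (formulaToks F0)).reverse } with hρ₁₂
  have h4 : Runs (restrictPass false false .f3) (mk ρ₁₁) (mk ρ₁₂)
      (A.length * (10 * (x₀.length + (4 + x₀.length) * A.length) + 50) + 10) := by
    have := runs_restrictPass false false R.f3 (Or.inr rfl) F ρ₁₁ (by simp [hρ₁₁]) (by simp [hρ₁₁])
      (by simp [hρ₁₁]) (by simp [hρ₁₁]) (by simp [hρ₁₁]) (by simp [hρ₁₁]) (by simp [hρ₁₁]) (by simp [hρ₁₁])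
      (by simp [hρ₁₁, hA])
    refine this.of_eq ?_ (by simp [hρ₁₁, hA])
    simp [hρ₁₁, hρ₁₂, setSrc, hF0, hA]
  have h5 : Runs (emit R.o .endf) (mk ρ₁₂) (mk { ρ₁₂ with o := Tok.endf.code.reverse ++ ρ₁₂.o }) 5 :=
    (runs_emit R.o .endf (mk ρ₁₂)).of_eq (by simp [hρ₁₂]) le_rfl
  set ρ₁₃ : RF :=
      { RF.zero with
        w := bits (formulaToks F0) ++ Tok.endf.code ++ wTrue b F1 (bits (wl W)), x := x₀,
        bu := List.replicate b true } with hρ₁₃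
  have h6 : Runs (pour R.o R.w) (mk { ρ₁₂ with o := Tok.endf.code.reverse ++ ρ₁₂.o }) (mk ρ₁₃)
      (3 * ((bits (formulaToks F0)).length + 5) + 1) :=
    (runs_pour (a := R.o) (b := R.w) (by decide) _).of_eq (by simp [hρ₁₂, hρ₁₃, hρ₁₁, Tok.code])
      (by simp [hρ₁₂, hρ₁₁, Tok.code])
  have h7 := runs_pushUnits_bu b ρ₁₃ (by simp [hρ₁₃])
  have h7' : Runs (.loop .bu pushUnit pushUnit) (mk ρ₁₃)
      (mk
          { RF.zero with
            w := bits (List.replicate b Tok.unit) ++ (bits (formulaToks F0) ++ Tok.endf.code ++ wTrue b F1 (bits (wl W))),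
            x := x₀ }) (7 * b + 1) := by
    refine h7.of_eq ?_ le_rfl
    simp [hρ₁₃]
  have h8 : Runs (clear R.x) (mk
      { RF.zero with
        w := bits (List.replicate b Tok.unit) ++ (bits (formulaToks F0) ++ Tok.endf.code ++ wTrue b F1 (bits (wl W))),
        x := x₀ }) (mk (stW (bits (List.replicate b Tok.unit) ++ (bits (formulaToks F0) ++
        Tok.endf.code ++ wTrue b F1 (bits (wl W)))))) (2 * x₀.length + 1) :=
    (runs_clear R.x _).of_eq (by simp [stW]) (by simp)
  refine (h1.seq (h2.seq (h3.seq (h4.seq (h5.seq (h6.seq (h7'.seq h8))))))).mono ?_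
  omega

/-- The new worklist after a split is the code of the worklist of `searchB`. [folklore] -/
theorem split_wl_eq (x₀ : List Bool) :
    bits (List.replicate b Tok.unit) ++ (bits (formulaToks (restrict F x₀ false)) ++ Tok.endf.code ++
      wTrue b (restrict F x₀ true) (bits (wl W))) =
    bits (wl ((b, restrict F x₀ false) ::
      (if b = 0 then W else (b - 1, restrict F x₀ true) :: W))) := by
  rcases b with _ | b
  · simp [wTrue]
  · simp [wTrue, List.append_assoc]

/-- **The body on an entry to split** (`F ≠ []`, no empty clause, pivot `x₀`, budget `b`): the
worklist becomes `(b, F[x₀:=false]), [(b-1, F[x₀:=true]) if b ≥ 1], rest`.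
[cite: ImpagliazzoPaturiJCSS2001, p. 370; Davis–Logemann–Loveland 1962] -/
theorem runs_body_split (hF : F ≠ []) (he : [] ∉ F) {x₀ : List Bool} (hp : pivot F = some x₀)
    {t : Tok} {ts : List Tok} (hts : wl ((b, F) :: W) = t :: ts) :
    Runs (body t.hd) (mk (stW (t.tl ++ bits ts)))
      (mk (stW (bits (wl ((b, restrict F x₀ false) ::
        (if b = 0 then W else (b - 1, restrict F x₀ true) :: W))))))
      (2 * reBound (bits (wl ((b, F) :: W))).length + 88 * (bits (wl ((b, F) :: W))).length + 99) := by
  have hx : scanX F = x₀ := scanX_eq_of_pivot hp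
  have hxl : x₀.length ≤ (bits (wl ((b, F) :: W))).length := by
    rw [← hx]
    refine (length_scanX_le F).trans ((length_le_length_bits _).trans ?_)
    simp only [wl_cons, bits_append, bits_cons, List.length_append]; omega
  have hS := runs_splitStep b F W x₀ hxl
  rw [split_wl_eq] at hS
  set ρ₆ : RF :=
    { RF.zero with
      w2 := (bits (wl W)).reverse, f2 := bits (formulaToks F),
      x := scanX F, he := if [] ∈ F then [true] else [], bu := List.replicate b true } with hρ₆
  have hK : Runs (.pop .he (clear .f2 ;; clear .x ;; clear .bu ;; pour .w2 .w)
      (clear .f2 ;; clear .x ;; clear .bu ;; pour .w2 .w) splitStep) (mk ρ₆)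
      (mk (stW (bits (wl ((b, restrict F x₀ false) ::
        (if b = 0 then W else (b - 1, restrict F x₀ true) :: W))))))
      (2 * reBound (bits (wl ((b, F) :: W))).length + 40 * (bits (wl ((b, F) :: W))).length + 60 + 2) := by
    refine Runs.pop_nil _ _ (by simp [hρ₆, he]) ?_
    have e6 : ρ₆ =
        { RF.zero with
          w2 := (bits (wl W)).reverse, f2 := bits (formulaToks F), x := x₀,
          bu := List.replicate b true } := by
      simp [hρ₆, he, hx]
    rw [e6]
    exact hS
  have H := (runs_bodyAB b F W hts).1 (runs_bodyCDE b F W hF hK)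
  refine H.mono ?_
  omega

end Body

/-! ### The prelude -/

/-- The budget computed by the prelude: `⌊min(n, N (m + 1)) / N⌋`, `m` the number of literal
occurrences. [folklore] -/
def budget (N n : ℕ) (F : CNF (List Bool)) : ℕ := min n (N * (CNF.size F + 1)) / N

/-- The budget is `min (⌊n / N⌋, m + 1)`. [folklore] -/
theorem budget_eq (N n : ℕ) (hN : 1 ≤ N) (F : CNF (List Bool)) :
    budget N n F = min (n / N) (CNF.size F + 1) := by
  unfold budget
  by_cases h : n ≤ N * (CNF.size F + 1)
  · rw [Nat.min_eq_left h]
    symm; apply Nat.min_eq_left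
    calc n / N ≤ N * (CNF.size F + 1) / N := Nat.div_le_div_right h
      _ = CNF.size F + 1 := by rw [Nat.mul_comm, Nat.mul_div_cancel _ (by omega)]
  · rw [Nat.min_eq_right (by omega), Nat.mul_comm, Nat.mul_div_cancel _ (by omega)]
    symm; apply Nat.min_eq_right
    calc CNF.size F + 1 = N * (CNF.size F + 1) / N := by rw [Nat.mul_comm, Nat.mul_div_cancel _ (by omega)]
      _ ≤ n / N := Nat.div_le_div_right (by omega)

/-- The budget is at most `⌊n / N⌋`. [folklore] -/
theorem budget_le_div (N n : ℕ) (hN : 1 ≤ N) (F : CNF (List Bool)) : budget N n F ≤ n / N := by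
  rw [budget_eq N n hN]; exact Nat.min_le_left _ _

/-- The budget is at most `m + 1`. [folklore] -/
theorem budget_le_size (N n : ℕ) (hN : 1 ≤ N) (F : CNF (List Bool)) : budget N n F ≤ CNF.size F + 1 := by
  rw [budget_eq N n hN]; exact Nat.min_le_right _ _

/-- The number of literal occurrences is at most the number of tokens. [folklore] -/
theorem size_le_length_formulaToks (F : CNF (List Bool)) : CNF.size F ≤ (formulaToks F).length := by
  induction F with
  | nil => simp
  | cons c F ih =>
    simp only [CNF.size_cons, formulaToks_cons, List.length_append, clauseToks, List.length_flatMap,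
      List.length_singleton]
    have : c.length ≤ (c.map fun l => (litToks l).length).sum := by
      induction c with
      | nil => simp
      | cons l c ihc => simp [litToks]; omega
    omega

/-- **The prelude lays out the initial worklist** `unit^q code(F) endf`, `q = budget N n F`, from
the coded input `code(header n) code(F)`, within `100 N (m₀ + 1)²` steps, `m₀` the input length.
[cite: ImpagliazzoPaturiJCSS2001, p. 370 (threshold δn, δ = 1/N)] -/
theorem runs_prelude (N : ℕ) (hN : 1 ≤ N) (n : ℕ) (F : CNF (List Bool)) :
    Runs (prelude N) (mk (stW (bits (hdrToks n ++ formulaToks F))))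
      (mk (stW (bits (wl [(budget N n F, F)]))))
      (100 * N * ((bits (hdrToks n ++ formulaToks F)).length + 1) ^ 2) := by
  set m₀ := (bits (hdrToks n ++ formulaToks F)).length with hm₀
  set S := N * (CNF.size F + 1) with hS
  -- the header pass
  have h1 := runs_hdrLoop N (hdrToks n ++ formulaToks F) (stW (bits (hdrToks n ++ formulaToks F)))
    (Or.inl rfl) rfl
  have e1 : hdF N (hdrToks n ++ formulaToks F) (stW (bits (hdrToks n ++ formulaToks F))) =
      { stW (bits (hdrToks n ++ formulaToks F)) with
        hd := (encodeNat n).reverse, md := [true],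
        fr := (bits (formulaToks F)).reverse, cc := List.replicate (N * CNF.size F) true } := by
    rw [hdF_append, hdF_hdrToks N n _ rfl, hdF_formulaToks N F _ rfl]
    simp [stW]
  rw [e1] at h1
  set ρ₁ : RF :=
    { RF.zero with
      hd := (encodeNat n).reverse, md := [true],
      fr := (bits (formulaToks F)).reverse, cc := List.replicate (N * CNF.size F) true } with hρ₁
  have h1' : Runs (tokLoop .w (hdrH N)) (mk (stW (bits (hdrToks n ++ formulaToks F)))) (mk ρ₁)
      ((N + 18) * (hdrToks n ++ formulaToks F).length + 1) :=
    h1.of_eq (by simp [setW, stW, hρ₁]) le_rfl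
  -- clear md, complete the capacity
  have h2 : Runs (clear R.md) (mk ρ₁) (mk { ρ₁ with md := [] }) 3 :=
    (runs_clear R.md (mk ρ₁)).of_eq (by simp [hρ₁]) (by simp [hρ₁])
  set ρ₃ : RF :=
    { RF.zero with
      hd := (encodeNat n).reverse, fr := (bits (formulaToks F)).reverse,
      cc := List.replicate S true } with hρ₃
  have hNS : N + N * CNF.size F = S := by rw [hS]; ring
  have h3 : Runs (GenProg.pushes R.cc (List.replicate N true)) (mk { ρ₁ with md := [] }) (mk ρ₃) N := by
    refine (GenProg.runs_pushes R.cc _ _).of_eq ?_ (by simp)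
    simp [hρ₁, hρ₃, hNS]
  -- the doubling loop
  have h4 := runs_dblLoop S (encodeNat n).reverse 0 ρ₃ (Nat.zero_le _) (by simp [hρ₃]) (by simp [hρ₃])
    (by simp [hρ₃]) (by simp [hρ₃])
  have hval : satFold S (encodeNat n).reverse 0 = min n S := by
    rw [satFold_eq S _ 0 (Nat.zero_le _), msbFold_reverse_encodeNat]
  rw [hval] at h4
  set ρ₅ : RF :=
    { RF.zero with
      fr := (bits (formulaToks F)).reverse, uu := List.replicate (min n S) true,
      cc := List.replicate (S - min n S) true } with hρ₅
  have h4' : Runs (.loop .hd (dblBody true) (dblBody false)) (mk ρ₃) (mk ρ₅)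
      ((encodeNat n).length * (9 * S + 7) + 1) :=
    h4.of_eq (by simp [hρ₃, hρ₅]) (by simp)
  -- lay out `code(F) endf`
  have h5 : Runs (GenProg.pushes R.w Tok.endf.code.reverse) (mk ρ₅) (mk { ρ₅ with w := Tok.endf.code }) 5 :=
    (GenProg.runs_pushes R.w _ _).of_eq (by simp [hρ₅]) (by simp [Tok.code])
  set ρ₇ : RF :=
    { RF.zero with
      w := bits (formulaToks F) ++ Tok.endf.code, uu := List.replicate (min n S) true,
      cc := List.replicate (S - min n S) true } with hρ₇
  have h6 : Runs (pour R.fr R.w) (mk { ρ₅ with w := Tok.endf.code }) (mk ρ₇)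
      (3 * (bits (formulaToks F)).length + 1) :=
    (runs_pour (a := R.fr) (b := R.w) (by decide) _).of_eq (by simp [hρ₅, hρ₇]) (by simp [hρ₅])
  -- the grouping loop and the cleanup
  have h7 := runs_grpLoop N hN (min n S) ρ₇ (by simp [hρ₇])
  have h8 : Runs (clear R.cc)
      (mk { ρ₇ with uu := [], w := bits (List.replicate (min n S / N) Tok.unit) ++ ρ₇.w })
      (mk (stW (bits (wl [(budget N n F, F)])))) (2 * (S - min n S) + 1) :=
    (runs_clear R.cc _).of_eq (by simp [hρ₇, stW, budget, hS]) (by simp [hρ₇])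
  refine (h1'.seq (h2.seq (h3.seq (h4'.seq (h5.seq (h6.seq (h7.seq h8))))))).mono ?_
  -- sizes
  have hl1 : (hdrToks n ++ formulaToks F).length ≤ m₀ := length_le_length_bits _
  have hl2 : (encodeNat n).length ≤ m₀ := by
    have : (encodeNat n).length ≤ (hdrToks n ++ formulaToks F).length := by simp [hdrToks]
    exact this.trans hl1
  have hl3 : (bits (formulaToks F)).length ≤ m₀ := by simp [hm₀]
  have hl4 : CNF.size F ≤ m₀ := (size_le_length_formulaToks F).trans
    ((length_le_length_bits _).trans hl3)
  have hS1 : S ≤ N * (m₀ + 1) := by rw [hS]; exact Nat.mul_le_mul_left N (by omega)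
  have hmin : min n S ≤ S := Nat.min_le_right _ _
  have hN1 : 1 ≤ N := hN
  -- every summand against `X = N (m₀+1) m₀` and `Y = N (m₀+1)`
  have c1 : (N + 18) * (hdrToks n ++ formulaToks F).length ≤ (N + 18) * m₀ :=
    Nat.mul_le_mul_left _ hl1
  have c2 : (encodeNat n).length * (9 * S + 7) ≤ m₀ * (9 * (N * (m₀ + 1)) + 7) :=
    Nat.mul_le_mul hl2 (by omega)
  have e1 : m₀ * (9 * (N * (m₀ + 1)) + 7) = 9 * (N * (m₀ + 1) * m₀) + 7 * m₀ := by ring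
  have e2 : (N + 18) * m₀ = N * m₀ + 18 * m₀ := by ring
  have e3 : 100 * N * (m₀ + 1) ^ 2 = 100 * (N * (m₀ + 1) * m₀) + 100 * (N * (m₀ + 1)) := by ring
  have f1 : N * m₀ ≤ N * (m₀ + 1) * m₀ :=
    Nat.mul_le_mul_right m₀ (Nat.le_mul_of_pos_right N (Nat.succ_pos _))
  have f2 : m₀ ≤ N * (m₀ + 1) := le_trans (Nat.le_succ _) (Nat.le_mul_of_pos_left _ hN)
  have f3 : 1 ≤ N * (m₀ + 1) := Nat.one_le_iff_ne_zero.2 (by positivity)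
  rw [e3]
  rw [e1] at c2
  rw [e2] at c1
  omega

/-! ### The worklist loop -/

/-- The cost of one iteration, from the number of variables `d`, the code length `m₀` of the
input formula and the budget bound `B₀` (the worklist holds at most `d + 1` entries). [folklore] -/
def bodyBound (d m₀ B₀ : ℕ) : ℕ :=
  2 * reBound ((d + 1) * (5 * B₀ + m₀ + 5)) + 88 * ((d + 1) * (5 * B₀ + m₀ + 5)) + 99

/-- `reBound` is monotone. [folklore] -/
theorem reBound_mono {a c : ℕ} (h : a ≤ c) : reBound a ≤ reBound c := by
  unfold reBound; gcongr

/-- One round of the worklist loop: pop the first bit, run the body, continue. [folklore] -/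
theorem mainLoop_step {c : Bool} {l rest : List Bool} {R₁ R₂ : Regs R} {B₁ B₂ : ℕ}
    (hw : l = c :: rest) (h₁ : Runs (body c) (mk (stW rest)) R₁ B₁) (h₂ : Runs mainLoop R₁ R₂ B₂) :
    Runs mainLoop (mk (stW l)) R₂ (B₁ + 2 + B₂) := by
  have hR : Function.update (mk (stW l)) R.w rest = mk (stW rest) := by simp [stW]
  cases c
  · exact Runs.loop_false' (by simp [stW, hw]) hR h₁ h₂
  · exact Runs.loop_true' (by simp [stW, hw]) hR h₁ h₂

/-- One round of the worklist loop, the rest stopping. [folklore] -/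
theorem mainLoop_step_halts {c : Bool} {l rest : List Bool} {R₁ R₂ : Regs R} {B₁ B₂ : ℕ}
    (hw : l = c :: rest) (h₁ : Runs (body c) (mk (stW rest)) R₁ B₁) (h₂ : Halts mainLoop R₁ R₂ B₂) :
    Halts mainLoop (mk (stW l)) R₂ (B₁ + 2 + B₂) := by
  have hR : Function.update (mk (stW l)) R.w rest = mk (stW rest) := by simp [stW]
  cases c
  · exact Runs.loop_false_halts' (by simp [stW, hw]) hR h₁ h₂
  · exact Runs.loop_true_halts' (by simp [stW, hw]) hR h₁ h₂

/-- A round of the worklist loop whose body stops the program. [folklore] -/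
theorem mainLoop_stop {c : Bool} {l rest : List Bool} {R₁ : Regs R} {B₁ : ℕ}
    (hw : l = c :: rest) (h₁ : Halts (body c) (mk (stW rest)) R₁ B₁) :
    Halts mainLoop (mk (stW l)) R₁ (B₁ + 2) := by
  have hR : Function.update (mk (stW l)) R.w rest = mk (stW rest) := by simp [stW]
  cases c
  · exact Halts.loop_false' _ (by simp [stW, hw]) hR h₁
  · exact Halts.loop_true' _ (by simp [stW, hw]) hR h₁

/-- **The worklist loop realises the budgeted search.** With fuel `n ≥ Σ nodesB`, under the
worklist invariant for `d` variables and uniform bounds `m₀` (codes) and `B₀` (budgets) on the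
pending entries: if `searchB n W` the loop stops the program with `[true]` in `out`, otherwise
it runs out of work with all registers empty; within `n · (bodyBound d m₀ B₀ + 2) + 1` steps.
[cite: ImpagliazzoPaturiJCSS2001, p. 370; Davis–Logemann–Loveland 1962] -/
theorem mainLoop_spec (d m₀ B₀ : ℕ) : ∀ (n : ℕ) (W : List (ℕ × CNF (List Bool))),
    (W.map fun p => nodesB p.1 p.2).sum ≤ n → WInv d W →
    (∀ p ∈ W, (bits (formulaToks p.2)).length ≤ m₀ ∧ p.1 ≤ B₀) →
    (searchB n W = true → Halts mainLoop (mk (stW (bits (wl W)))) (mk { RF.zero with out := [true] })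
      (n * (bodyBound d m₀ B₀ + 2) + 1)) ∧
    (searchB n W = false → Runs mainLoop (mk (stW (bits (wl W)))) (mk RF.zero)
      (n * (bodyBound d m₀ B₀ + 2) + 1)) := by
  intro n
  induction n with
  | zero =>
    intro W hsum _ _
    refine ⟨fun h => by simp [searchB] at h, fun _ => ?_⟩
    match W with
    | [] =>
      exact (Runs.loop_nil (body true) (body false) (R := mk RF.zero) (k := R.w) rfl :
        Runs mainLoop (mk RF.zero) (mk RF.zero) 1).mono (by omega)
    | (b, F) :: W => have := one_le_nodesB b F; simp at hsum; omega
  | succ n ih =>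
    intro W hsum hinv hbd
    match W with
    | [] =>
      refine ⟨fun h => by simp [searchB] at h, fun _ => ?_⟩
      exact (Runs.loop_nil (body true) (body false) (R := mk RF.zero) (k := R.w) rfl :
        Runs mainLoop (mk RF.zero) (mk RF.zero) 1).mono (by omega)
    | (b, F) :: W =>
      obtain ⟨t, ts, h1⟩ := wl_cons_eq_cons b F W
      have hw : bits (wl ((b, F) :: W)) = t.hd :: (t.tl ++ bits ts) := by
        rw [h1, bits_cons, Tok.code_eq]; rfl
      -- size of the current worklist
      have hm : (bits (wl ((b, F) :: W))).length ≤ (d + 1) * (5 * B₀ + m₀ + 5) :=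
        (length_bits_wl_le _ m₀ B₀ hbd).trans (Nat.mul_le_mul_right _ hinv.length_le)
      have hRB := reBound_mono hm
      have hbF := hbd (b, F) (by simp)
      simp only [List.map_cons, List.sum_cons] at hsum
      by_cases hF : F = []
      · subst hF
        refine ⟨fun _ => ?_, fun h => by simp [searchB] at h⟩
        have H := mainLoop_stop hw (halts_body_nil b W h1)
        refine H.mono ?_
        unfold bodyBound; nlinarith
      by_cases he : [] ∈ F
      · -- drop
        have hs : searchB (n + 1) ((b, F) :: W) = searchB n W := by simp [searchB, hF, he]
        have hB := runs_body_drop b F W hF he h1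
        have hnF := one_le_nodesB b F
        obtain ⟨ihT, ihF⟩ := ih W (by omega) hinv.tail (fun p hp => hbd p (by simp [hp]))
        rw [hs]
        refine ⟨fun h => (mainLoop_step_halts hw hB (ihT h)).mono ?_,
          fun h => (mainLoop_step hw hB (ihF h)).mono ?_⟩ <;>
        · unfold bodyBound; nlinarith
      · -- split
        obtain ⟨x₀, hp⟩ := Option.isSome_iff_exists.1 (pivot_isSome hF he)
        have hs : searchB (n + 1) ((b, F) :: W) = searchB n ((b, restrict F x₀ false) ::
            (if b = 0 then W else (b - 1, restrict F x₀ true) :: W)) := by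
          simp [searchB, hF, he, hp]
        have hB := runs_body_split b F W hF he hp h1
        have hxF := mem_vars_of_pivot hp
        have hnodes := nodesB_of_pivot hF he hp b
        obtain ⟨ihT, ihF⟩ := ih ((b, restrict F x₀ false) ::
            (if b = 0 then W else (b - 1, restrict F x₀ true) :: W))
          (by
            by_cases hb : b = 0
            · simp only [hb, ↓reduceIte, List.map_cons, List.sum_cons] at hnodes ⊢
              subst hb; omega
            · simp only [hb, ↓reduceIte, List.map_cons, List.sum_cons] at hnodes ⊢; omega)
          (by
            by_cases hb : b = 0
            · simp only [hb, ↓reduceIte]; subst hb; exact hinv.push1 hxF false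
            · simp only [hb, ↓reduceIte]; exact hinv.split hxF)
          (by
            intro p hp'
            by_cases hb : b = 0
            · simp only [hb, ↓reduceIte, List.mem_cons] at hp'
              rcases hp' with rfl | hp'
              · exact ⟨(length_bits_formulaToks_restrict_le F x₀ false).trans hbF.1, by simp⟩
              · exact hbd p (by simp [hp'])
            · simp only [hb, ↓reduceIte, List.mem_cons] at hp'
              rcases hp' with rfl | rfl | hp'
              · exact ⟨(length_bits_formulaToks_restrict_le F x₀ false).trans hbF.1, hbF.2⟩
              · exact ⟨(length_bits_formulaToks_restrict_le F x₀ true).trans hbF.1, by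
                  simp only; exact le_trans (Nat.sub_le _ _) hbF.2⟩
              · exact hbd p (by simp [hp']))
        rw [hs]
        refine ⟨fun h => (mainLoop_step_halts hw hB (ihT h)).mono ?_,
          fun h => (mainLoop_step hw hB (ihF h)).mono ?_⟩ <;>
        · unfold bodyBound; nlinarith

/-! ### The whole program -/

/-- The answer bit of the budgeted search on `F` with budget `q`. [folklore] -/
def answer (q : ℕ) (F : CNF (List Bool)) : Bool := searchB (nodesB q F) [(q, F)]

/-- The answer bit is light satisfiability with budget `q`. [folklore] -/
theorem answer_iff (q : ℕ) (F : CNF (List Bool)) : answer q F = true ↔ LightSat F q := by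
  rw [answer, searchB_iff (nodesB q F) [(q, F)] (by simp)]; simp

/-- The step bound of the search program on the input `(n, F)`. [folklore] -/
def progBound (N n : ℕ) (F : CNF (List Bool)) : ℕ :=
  100 * N * ((bits (hdrToks n ++ formulaToks F)).length + 1) ^ 2 + 2 +
    nodesB (budget N n F) F * (bodyBound (CNF.vars F).card (bits (formulaToks F)).length
      (budget N n F) + 2)

/-- **The search program decides light satisfiability with the computed budget**: started with
the coded input in `w`, it ends (by `halt` or by running out of work) with the answer bit in
`out` and all other registers empty, within `progBound` steps.
[cite: ImpagliazzoPaturiJCSS2001, p. 370 (exhaustive search of light assignments)] -/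
theorem exec_searchProg (N : ℕ) (hN : 1 ≤ N) (n : ℕ) (F : CNF (List Bool)) :
    ∃ (s : Bool) (t : ℕ), t ≤ progBound N n F ∧
      Exec (searchProg N) (Regs.init R.w (bits (hdrToks n ++ formulaToks F))) s
        (Regs.init R.out [answer (budget N n F) F]) t := by
  set q := budget N n F with hq
  have h1 := runs_prelude N hN n F
  obtain ⟨hT, hF⟩ := mainLoop_spec (CNF.vars F).card (bits (formulaToks F)).length q (nodesB q F)
    [(q, F)] (by simp) (WInv.singleton le_rfl) (by simp)
  rw [init_w, init_out, ← show stW (bits (hdrToks n ++ formulaToks F)) =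
    { RF.zero with w := bits (hdrToks n ++ formulaToks F) } from rfl]
  cases hs : answer q F
  · rw [answer] at hs
    have h5 : Runs (.push R.out false) (mk RF.zero) (mk { RF.zero with out := [false] }) 1 :=
      (Runs.push R.out false _).of_eq (by simp) le_rfl
    obtain ⟨t, ht, ex⟩ := h1.seq ((hF hs).seq h5)
    refine ⟨false, t, ?_, ex⟩
    simp only [progBound, ← hq]; omega
  · rw [answer] at hs
    obtain ⟨t, ht, ex⟩ := h1.seq_halts (Halts.seq (.push .out false) (hT hs))
    refine ⟨true, t, ?_, ex⟩
    simp only [progBound, ← hq]; omega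

/-! ### The machine -/

/-- The compiled search program as a `TM2` machine over bits (registers renamed to `Fin 28`). [folklore] -/
noncomputable def searchMachine (N : ℕ) : TM2ComputableAux Bool Bool :=
  (compile ((searchProg N).map (Fintype.equivFin R))).toAux (Fintype.equivFin R .w)
    (Fintype.equivFin R .out)

/-- **The search machine decides light satisfiability of coded inputs** within
`progBound + 1` steps. [folklore] -/
theorem searchMachine_outputsWithin (N : ℕ) (hN : 1 ≤ N) (n : ℕ) (F : CNF (List Bool)) :
    (searchMachine N).OutputsWithin (bits (hdrToks n ++ formulaToks F)) [answer (budget N n F) F]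
      (progBound N n F + 1) := by
  obtain ⟨s, t, ht, ex⟩ := exec_searchProg N hN n F
  exact (Com.outputsWithin_of_exec_equiv (Fintype.equivFin R) ex).mono (by omega)

/-! ### Light satisfiability with the capped budget -/

/-- `LightSat` is monotone in the budget. [folklore] -/
theorem lightSat_mono {F : CNF (List Bool)} {b b' : ℕ} (h : b ≤ b') (hF : LightSat F b) : LightSat F b' := by
  obtain ⟨a, ha, hb⟩ := hF
  exact ⟨a, ha, hb.trans h⟩

/-- A budget beyond the number of variables is no constraint. [folklore] -/
theorem lightSat_of_card_le {F : CNF (List Bool)} {b b' : ℕ} (hb : (CNF.vars F).card ≤ b)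
    (hF : LightSat F b') : LightSat F b := by
  obtain ⟨a, ha, -⟩ := hF
  exact ⟨a, ha, le_trans (Finset.card_le_card (Finset.filter_subset _ _)) hb⟩

/-- **The capped budget does not change the answer**: `LightSat F (budget N n F) ↔ LightSat F ⌊n/N⌋`
(`budget = min(⌊n/N⌋, m + 1)` and at most `#vars ≤ m` ones can be placed on the variables). [folklore] -/
theorem lightSat_budget_iff (N : ℕ) (hN : 1 ≤ N) (n : ℕ) (F : CNF (List Bool)) :
    LightSat F (budget N n F) ↔ LightSat F (n / N) := by
  rw [budget_eq N n hN]
  constructor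
  · exact lightSat_mono (Nat.min_le_left _ _)
  · intro h
    by_cases hc : n / N ≤ CNF.size F + 1
    · rwa [Nat.min_eq_left hc]
    · rw [Nat.min_eq_right (by omega)]
      exact lightSat_of_card_le (by have := card_vars_le_size F; omega) h

/-! ### Running time -/

/-- `reBound M ≤ 120 M³` for `M ≥ 1`. [folklore] -/
theorem reBound_le (M : ℕ) (hM : 1 ≤ M) : reBound M ≤ 120 * M ^ 3 := by
  unfold reBound
  have h1 : M ≤ M * M := Nat.le_mul_self M
  have h2 : M * M ≤ M * M * M := Nat.le_mul_of_pos_right _ hM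
  nlinarith

/-- `bodyBound d m₀ B₀ + 2 ≤ 430 M³` with `M = (d + 1)(5 B₀ + m₀ + 5)`. [folklore] -/
theorem bodyBound_le (d m₀ B₀ : ℕ) :
    bodyBound d m₀ B₀ + 2 ≤ 430 * ((d + 1) * (5 * B₀ + m₀ + 5)) ^ 3 := by
  set M := (d + 1) * (5 * B₀ + m₀ + 5) with hM
  have hM1 : 1 ≤ M := by rw [hM]; exact Nat.one_le_iff_ne_zero.2 (by positivity)
  have h := reBound_le M hM1
  have h1 : M ≤ M ^ 3 := by
    calc M = M ^ 1 := (pow_one M).symm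
      _ ≤ M ^ 3 := Nat.pow_le_pow_right hM1 (by norm_num)
  have h2 : 1 ≤ M ^ 3 := Nat.one_le_pow _ _ hM1
  unfold bodyBound
  rw [← hM]
  omega

/-- The time bound of the whole decision procedure: a polynomial in `L` times the partial
binomial sum `Σ_{j ≤ ⌊n/N⌋} (n choose j)`. [folklore] -/
def timeBound (N n L : ℕ) : ℕ := 10000000000 * N * (L + 1) ^ 7 * sumChoose n (n / N)

/-- **The step bound of the whole decision procedure**: for a k-CNF `φ` with `n` variables and
encoding length `L`, transducer plus search machine take at most `timeBound N n L` steps. [folklore] -/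
theorem total_bound {k : ℕ} (N : ℕ) (hN : 1 ≤ N) (φ : KCNF k) :
    progBound N φ.numVars (formulaOf φ) + 1 + (5 * φ.encode.length + 3) ≤
      timeBound N φ.numVars φ.encode.length := by
  simp only [progBound, timeBound]
  have hzL : (bits (hdrToks φ.numVars ++ formulaToks (formulaOf φ))).length ≤ 4 * φ.encode.length :=
    length_bits_hdr_formulaOf_le φ
  have hFz : (bits (formulaToks (formulaOf φ))).length ≤
      (bits (hdrToks φ.numVars ++ formulaToks (formulaOf φ))).length := by simp
  have hdz : (CNF.vars (formulaOf φ)).card ≤ (bits (formulaToks (formulaOf φ))).length :=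
    (card_vars_le_length_formulaToks _).trans (length_le_length_bits _)
  have hdn : (CNF.vars (formulaOf φ)).card ≤ φ.numVars := card_vars_formulaOf_le φ
  have hq : budget N φ.numVars (formulaOf φ) ≤ CNF.size (formulaOf φ) + 1 := budget_le_size N _ hN _
  have hq' : budget N φ.numVars (formulaOf φ) ≤ φ.numVars / N := budget_le_div N _ hN _
  have hnl : CNF.size (formulaOf φ) ≤ (bits (formulaToks (formulaOf φ))).length :=
    (size_le_length_formulaToks _).trans (length_le_length_bits _)
  -- the number of nodes
  have hnodes : nodesB (budget N φ.numVars (formulaOf φ)) (formulaOf φ) ≤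
      ((CNF.vars (formulaOf φ)).card + 1) * sumChoose φ.numVars (φ.numVars / N) := by
    refine (nodesB_le _ _).trans (Nat.mul_le_mul_left _ ?_)
    exact (sumChoose_mono_left hdn _).trans (sumChoose_mono_right _ hq')
  have hB := bodyBound_le (CNF.vars (formulaOf φ)).card (bits (formulaToks (formulaOf φ))).length
    (budget N φ.numVars (formulaOf φ))
  generalize hz : (bits (hdrToks φ.numVars ++ formulaToks (formulaOf φ))).length = z at *
  generalize hzf : (bits (formulaToks (formulaOf φ))).length = zf at *
  generalize hd : (CNF.vars (formulaOf φ)).card = d at *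
  generalize hL : φ.encode.length = L at *
  generalize hNd : nodesB (budget N φ.numVars (formulaOf φ)) (formulaOf φ) = Nd at *
  generalize hBd : budget N φ.numVars (formulaOf φ) = q at *
  generalize hsc : sumChoose φ.numVars (φ.numVars / N) = sc at *
  generalize hnli : CNF.size (formulaOf φ) = nl at *
  have hsc1 : 1 ≤ sc := by rw [← hsc]; exact one_le_sumChoose _ _
  -- `M := (d+1)(5q + zf + 5) ≤ 120 (L+1)²`
  have hd1 : d + 1 ≤ 5 * (L + 1) := by omega
  have hM : (d + 1) * (5 * q + zf + 5) ≤ 120 * (L + 1) ^ 2 := by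
    have h2 : 5 * q + zf + 5 ≤ 24 * (L + 1) := by omega
    calc (d + 1) * (5 * q + zf + 5) ≤ (5 * (L + 1)) * (24 * (L + 1)) := Nat.mul_le_mul hd1 h2
      _ = 120 * (L + 1) ^ 2 := by ring
  have hB' : bodyBound d zf q + 2 ≤ 430 * (120 * (L + 1) ^ 2) ^ 3 :=
    hB.trans (Nat.mul_le_mul_left _ (Nat.pow_le_pow_left hM 3))
  have hpow : 430 * (120 * (L + 1) ^ 2) ^ 3 = 743040000 * (L + 1) ^ 6 := by ring
  rw [hpow] at hB'
  -- `P := sc (L+1)^7`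
  set P := sc * (L + 1) ^ 7 with hP
  have hL1 : 1 ≤ (L + 1) ^ 6 := Nat.one_le_pow _ _ (by omega)
  have hP1 : (L + 1) ^ 7 ≤ P := Nat.le_mul_of_pos_left _ hsc1
  have hL7 : L + 1 ≤ (L + 1) ^ 7 := by
    calc L + 1 = (L + 1) ^ 1 := (pow_one _).symm
      _ ≤ (L + 1) ^ 7 := Nat.pow_le_pow_right (by omega) (by norm_num)
  have hL27 : (L + 1) ^ 2 ≤ (L + 1) ^ 7 := Nat.pow_le_pow_right (by omega) (by norm_num)
  -- term 1: the loop
  have t1 : Nd * (bodyBound d zf q + 2) ≤ 3715200000 * P := by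
    calc Nd * (bodyBound d zf q + 2) ≤ ((d + 1) * sc) * (743040000 * (L + 1) ^ 6) :=
          Nat.mul_le_mul hnodes hB'
      _ ≤ (5 * (L + 1) * sc) * (743040000 * (L + 1) ^ 6) :=
          Nat.mul_le_mul_right _ (Nat.mul_le_mul_right _ hd1)
      _ = 3715200000 * P := by rw [hP]; ring
  -- term 2: the prelude
  have t2 : 100 * N * (z + 1) ^ 2 ≤ 2500 * (N * P) := by
    have h1 : (z + 1) ^ 2 ≤ 25 * (L + 1) ^ 2 := by
      calc (z + 1) ^ 2 ≤ (5 * (L + 1)) ^ 2 := Nat.pow_le_pow_left (by omega) 2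
        _ = 25 * (L + 1) ^ 2 := by ring
    calc 100 * N * (z + 1) ^ 2 ≤ 100 * N * (25 * (L + 1) ^ 2) := Nat.mul_le_mul_left _ h1
      _ ≤ 100 * N * (25 * P) := Nat.mul_le_mul_left _ (Nat.mul_le_mul_left _ (hL27.trans hP1))
      _ = 2500 * (N * P) := by ring
  -- term 3: the rest
  have t3 : 2 + 1 + (5 * L + 3) ≤ 6 * P := by
    calc 2 + 1 + (5 * L + 3) ≤ 6 * (L + 1) := by omega
      _ ≤ 6 * P := Nat.mul_le_mul_left _ (hL7.trans hP1)
  have hNP : P ≤ N * P := Nat.le_mul_of_pos_left _ hN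
  have e : 10000000000 * N * (L + 1) ^ 7 * sc = 10000000000 * (N * P) := by rw [hP]; ring
  rw [e]
  omega

/-- **Exhaustive search of light assignments** (Impagliazzo–Paturi 2001, p. 370 and proof of
Theorem 3, step 1): discharge of the named fact `Literature.Computability.FineGrained.lightKSAT_exhaustiveSearch`.
The machine is the input transducer (`recodeFST`, linear time) followed by the compiled
budgeted splitting search (`searchMachine N`); its search tree has at most
`(d + 1) Σ_{j ≤ ⌊n/N⌋} (n choose j) ≤ (d + 1) 2^{h(1/N) n}` nodes (van Lint), each costing a
polynomial in `L`. [cite: ImpagliazzoPaturiJCSS2001, p. 370 and proof of Theorem 3, step 1 (p. 374)] -/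
theorem lightKSAT_exhaustiveSearch_holds : lightKSAT_exhaustiveSearch := by
  intro k N hN
  have hN1 : 1 ≤ N := by omega
  obtain ⟨Mr, hMr⟩ := exists_recode_machine (k := k)
  refine ⟨fun n L => timeBound N n L, ⟨10000000000 * N, fun n L => ?_⟩,
    ⟨Mr.comp (searchMachine N), fun φ => ?_⟩⟩
  · have h1 := sumChoose_le_two_rpow n N hN
    have hL : (1 : ℝ) ≤ (L : ℝ) + 1 := by simp
    have hc : 7 ≤ 10000000000 * N := by omega
    have hp : ((L : ℝ) + 1) ^ 7 ≤ ((L : ℝ) + 1) ^ (10000000000 * N) := pow_le_pow_right₀ hL hc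
    simp only [timeBound]
    push_cast
    have h0 : (0 : ℝ) ≤ 10000000000 * N * ((L : ℝ) + 1) ^ 7 := by positivity
    calc (10000000000 : ℝ) * N * ((L : ℝ) + 1) ^ 7 * (sumChoose n (n / N) : ℝ)
        ≤ 10000000000 * N * ((L : ℝ) + 1) ^ 7 *
            (2 : ℝ) ^ (Real.binEntropy (N : ℝ)⁻¹ / Real.log 2 * n) :=
          mul_le_mul_of_nonneg_left h1 h0
      _ = 10000000000 * N * (2 : ℝ) ^ (Real.binEntropy (N : ℝ)⁻¹ / Real.log 2 * n) *
            ((L : ℝ) + 1) ^ 7 := by ring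
      _ ≤ 10000000000 * N * (2 : ℝ) ^ (Real.binEntropy (N : ℝ)⁻¹ / Real.log 2 * n) *
          ((L : ℝ) + 1) ^ (10000000000 * N) := mul_le_mul_of_nonneg_left hp (by positivity)
  · have h1 := hMr φ
    have h2 := searchMachine_outputsWithin N hN1 φ.numVars (formulaOf φ)
    have h3 := TM2ComputableAux.comp_outputsWithin Mr (searchMachine N) h1 h2
    have hdec : [answer (budget N φ.numVars (formulaOf φ)) (formulaOf φ)] =
        encodeBool (decide (φ.LightSatisfiable (φ.numVars / N))) := by
      have : answer (budget N φ.numVars (formulaOf φ)) (formulaOf φ) =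
          decide (φ.LightSatisfiable (φ.numVars / N)) := by
        rw [Bool.eq_iff_iff, answer_iff, lightSat_budget_iff N hN1, lightSat_formulaOf_iff,
          decide_eq_true_iff]
      rw [this]; rfl
    rw [hdec] at h3
    exact ⟨(h3.mono (total_bound N hN1 φ)).some⟩

end Literature.Computability.FineGrained.LightSearch

/-- Re-export in the namespace of the fact: `Literature.Computability.FineGrained.lightKSAT_exhaustiveSearch_holds`. [cite: ImpagliazzoPaturiJCSS2001, p. 370 and proof of Theorem 3, step 1 (p. 374)] -/
theorem Literature.Computability.FineGrained.lightKSAT_exhaustiveSearch_holds : Literature.Computability.FineGrained.lightKSAT_exhaustiveSearch :=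
  Literature.Computability.FineGrained.LightSearch.lightKSAT_exhaustiveSearch_holds
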